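import Literature.Topology.FourManifolds.RegularFibre
import HarnessLib

/-!
# Maps into a regular fibre: smoothness of lifts, compact subsets

Topic `Literature/Topology/FourManifolds` (sequel of `RegularFibre.lean` / `SliceChartsCodim.lean`;
fact seat `provefact-Literature.Geometry.Symplectic.Oba2016_s-add47373d4`: the retraction
`Ψ : f⁻¹(Q) → F` of the product structure of a Lefschetz fibration, viewed as a map into the
fibre *manifold* `F°`).  Everything is proved; no named facts.

* `SliceChartFamilyCodim.contMDiffOn_lift`, `RegularFibreOn.contMDiffOn_lift` — **the universal
  property of an embedded submanifold** (Lee 2012, Cor. 5.30): a map into the slice subset /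
  regular fibre which, composed with the inclusion, is smooth on an open set, is smooth there as a
  map into the submanifold (in the level charts it reads `pr₁ ∘ (appendCLE hab)⁻¹ ∘ φ̂`);
* `RegularFibreOn.isCompact_iff_image_incl` — compact subsets of the fibre are those with compact
  image (the inclusion is an embedding).

## References

* J. M. Lee, *Introduction to Smooth Manifolds*, 2nd ed., GTM 218 (2012), Thm. 5.8, Cor. 5.30.
  [LeeSmoothManifolds2013]
* M. W. Hirsch, *Differential Topology*, GTM 33 (1976), Ch. 1 §3. [HirschDT1976]
-/

open scoped Manifold ContDiff Topology
open Set Function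

noncomputable section

namespace Literature.Topology.FourManifolds

universe u

variable {N' a b : ℕ} {H : Type*} [TopologicalSpace H]
  {I : ModelWithCorners ℝ (EuclideanSpace ℝ (Fin N')) H}
  {M : Type u} [TopologicalSpace M] [ChartedSpace H M] {hab : a + b = N'}
  {EN : Type*} [NormedAddCommGroup EN] [NormedSpace ℝ EN] {HN : Type*} [TopologicalSpace HN]
  {IN : ModelWithCorners ℝ EN HN} {P : Type*} [TopologicalSpace P] [ChartedSpace HN P]

namespace SliceChartFamilyCodim

variable {S : Set M} (Ψ : SliceChartFamilyCodim I hab S)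

/-- **Universal property of a slice subset** (Lee 2012, Cor. 5.30): if `Φl : P → S` agrees on
the open set `s` with a map `φ : P → M` smooth on `s`, then `Φl` is smooth on `s` for the smooth
structure `Ψ.chartedSpace`: continuity because the inclusion is inducing, and in the level chart
at `Φl n` the map reads `pr₁ ∘ (appendCLE hab)⁻¹ ∘ ((Ψ.chart _).extend I) ∘ φ`.
[cite: LeeSmoothManifolds2013, Cor. 5.30] -/
theorem contMDiffOn_lift [IsManifold I ∞ M] {φ : P → M} {s : Set P} (hs : IsOpen s)
    (hφ : ContMDiffOn IN I ∞ φ s) {Φl : P → S} (hlift : ∀ n ∈ s, (Φl n : M) = φ n) :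
    letI := Ψ.chartedSpace
    ContMDiffOn IN (𝓡 a) ∞ Φl s := by
  letI := Ψ.chartedSpace
  haveI := Ψ.isManifold
  intro n hn
  have hsn : s ∈ 𝓝 n := hs.mem_nhds hn
  suffices h : ContMDiffAt IN (𝓡 a) ∞ Φl n from h.contMDiffWithinAt
  rw [contMDiffAt_iff_target]
  have hev : (fun n' => (Φl n' : M)) =ᶠ[𝓝 n] φ := by
    filter_upwards [hsn] with n' hn' using hlift n' hn'
  set q : S := Φl n with hq
  have hqφ : (q : M) = φ n := hlift n hn
  refine ⟨?_, ?_⟩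
  · -- continuity: the inclusion is inducing
    rw [Topology.IsInducing.subtypeVal.continuousAt_iff]
    exact ((hφ n hn).contMDiffAt hsn).continuousAt.congr hev.symm
  · -- in the level chart at `q`
    have hform : (extChartAt (𝓡 a) q ∘ Φl) =
        fun n' => ((appendCLE hab).symm ((Ψ.chart q).extend I (Φl n' : M))).1 := by
      funext n'
      rfl
    rw [hform]
    have hmem : φ n ∈ (Ψ.chart q).source := by rw [← hqφ]; exact Ψ.mem_source q
    have h1 : ContMDiffAt IN 𝓘(ℝ, EuclideanSpace ℝ (Fin N')) ∞ (((Ψ.chart q).extend I) ∘ φ) n :=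
      ((Ψ.chart q).contMDiffAt_extend (Ψ.mem_maximalAtlas q) hmem).comp n ((hφ n hn).contMDiffAt hsn)
    have h2 : ContMDiffAt IN 𝓘(ℝ, EuclideanSpace ℝ (Fin a)) ∞
        ((fun y => ((appendCLE hab).symm y).1) ∘ (((Ψ.chart q).extend I) ∘ φ)) n :=
      (contDiff_appendCLE_symm_fst (hab := hab)).contMDiff.contMDiffAt.comp n h1
    refine h2.congr_of_eventuallyEq ?_
    filter_upwards [hev] with n' hn'
    simp only [comp_apply, hn']

/-- Global version of `contMDiffOn_lift`. [cite: LeeSmoothManifolds2013, Cor. 5.30] -/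
theorem contMDiff_lift [IsManifold I ∞ M] {φ : P → M} (hφ : ContMDiff IN I ∞ φ) {Φl : P → S}
    (hlift : ∀ n, (Φl n : M) = φ n) :
    letI := Ψ.chartedSpace
    ContMDiff IN (𝓡 a) ∞ Φl := by
  letI := Ψ.chartedSpace
  have h := Ψ.contMDiffOn_lift isOpen_univ hφ.contMDiffOn (Φl := Φl) fun n _ => hlift n
  exact contMDiffOn_univ.1 h

end SliceChartFamilyCodim

namespace RegularFibreOn

variable {f : M → EuclideanSpace ℝ (Fin b)} {c : EuclideanSpace ℝ (Fin b)} {U : Set M}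

/-- **Universal property of the regular fibre** (Lee 2012, Cor. 5.30): a map into
`RegularFibreOn h` agreeing on the open `s` with a map smooth on `s` into `M` is smooth on `s`.
[cite: LeeSmoothManifolds2013, Cor. 5.30] -/
theorem contMDiffOn_lift [IsManifold I ∞ M] (h : IsRegularFibreOn I hab f c U) {φ : P → M}
    {s : Set P} (hs : IsOpen s) (hφ : ContMDiffOn IN I ∞ φ s) {Φl : P → RegularFibreOn h}
    (hlift : ∀ n ∈ s, incl h (Φl n) = φ n) : ContMDiffOn IN (𝓡 a) ∞ Φl s :=
  h.sliceChartFamily.contMDiffOn_lift hs hφ hlift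

/-- Global version of `RegularFibreOn.contMDiffOn_lift`. [cite: LeeSmoothManifolds2013, Cor. 5.30] -/
theorem contMDiff_lift [IsManifold I ∞ M] (h : IsRegularFibreOn I hab f c U) {φ : P → M}
    (hφ : ContMDiff IN I ∞ φ) {Φl : P → RegularFibreOn h} (hlift : ∀ n, incl h (Φl n) = φ n) :
    ContMDiff IN (𝓡 a) ∞ Φl :=
  h.sliceChartFamily.contMDiff_lift hφ hlift

/-- Compact subsets of the regular fibre are exactly those with compact image under the
inclusion (an embedding). [folklore] -/
theorem isCompact_iff_image_incl (h : IsRegularFibreOn I hab f c U) {K : Set (RegularFibreOn h)} :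
    IsCompact K ↔ IsCompact (incl h '' K) :=
  (isEmbedding_incl h).isCompact_iff

/-- The preimage under the inclusion of a compact subset of `M` contained in the fibre is
compact. [folklore] -/
theorem isCompact_preimage_incl (h : IsRegularFibreOn I hab f c U) {K : Set M} (hK : IsCompact K)
    (hKF : K ⊆ f ⁻¹' {c} ∩ U) : IsCompact (incl h ⁻¹' K) := by
  rw [isCompact_iff_image_incl, image_preimage_eq_of_subset (by rw [range_incl]; exact hKF)]
  exact hK

end RegularFibreOn

end Literature.Topology.FourManifolds

end
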